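import Literature.AlgebraicGeometry.HodgeTheory.HodgeLocus
import Literature.AlgebraicGeometry.HodgeTheory.IsoTransport
import Literature.AlgebraicGeometry.HodgeTheory.HodgeConjecture
import Literature.AlgebraicGeometry.HodgeTheory.HodgeModelExistence
import Literature.AlgebraicGeometry.Motives.CurveNet
import Literature.AlgebraicGeometry.Motives.SubschemeCycles
import Literature.AlgebraicGeometry.Motives.VarietiesProperProofs
import Summits.HodgeConjecture.HodgeConjecture.Statement
import Summits.HodgeConjecture.HodgeConjecture.Theorems.AnchorTransportVariationalHodgeTrivialFamily
import Summits.HodgeConjecture.HodgeConjecture.Theorems.AnchorTransportTargetIffHodgeConjecture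
import HarnessLib
import HarnessLib.Audit.Tags

/-!
# Transport and anchors: the Hodge conjecture as a variational statement plus an anchor supply

Solo-blind residency on `HodgeConjecture` (sessions s1–s3), the PATH of `PLAN.md` §2, kernel-checked.

Notation: `f : 𝒳 ⟶ S` a smooth projective family over `ℂ` (`Motives.IsSmoothProjectiveFamily f n`),
`FiberClass f (2p)` the espace étalé of `R²ᵖ f_* ℂ` on real carriers, `locusOfHodgeClasses f n p`
the pairs `(t, α)` with `α` a rational `(p,p)`-class on `𝒳_t` (Cattani–Deligne–Kaplan; Voisin 2007, §1),
and `connectedComponentIn (locusOfHodgeClasses f n p) x` the connected component of the locus of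
Hodge classes through `x` — the object whose image in `S(ℂ)` is "the Hodge locus of `α`"
(`hodgeLocusOfClass`). A fibre class `y` is *algebraic* when `y.cls ∈ algebraicClasses (𝒳_{y.pt}) p`.

* `Transport` **(T)** — Grothendieck's *variational Hodge conjecture* in the form "algebraicity is
  constant along connected components of the locus of Hodge classes": in a smooth projective family,
  if one class of a component is algebraic then every class of that component is algebraic
  (Grothendieck 1966, footnote 13; the conclusion of Bloch's semiregularity theorem, Invent. Math. 17
  (1972) Thm. 7.1/7.4, for semiregular local complete intersections, and of Buchweitz–Flenner 2003,
  Thm. 5.2/7.8, for semiregular sheaves).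
* `AnchorSupply` **(A)** — every Hodge class `(X, c)` on a smooth projective `X` is, after
  identifying `X` with a fibre of SOME smooth projective family, in the connected component of the
  locus of Hodge classes of SOME algebraic class (an "anchor": e.g. a Fermat or CM point where the
  Hodge conjecture is known).
* `∀ n X, HodgeTheory.nonempty_hodgeModel n X` — the anti-vacuity conjunct of `HodgeConjectureFor`
  for all smooth projective `X` (a THEOREM: Serre GAGA + de Rham + Hodge decomposition; in the tree the
  cited named fact `HodgeTheory.nonempty_hodgeModel`, used here only as a hypothesis).

Results (all sorry-free, pure logic over the tree's real carriers):

* `hodgeConjecture_of_transport_of_anchorSupply : (∀ n X, nonempty_hodgeModel n X) → Transport →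
  AnchorSupply → HodgeConjecture` (modus ponens along the component);
* `transport_of_hodgeConjecture`, `anchorSupply_of_hodgeConjecture` (the latter through the trivial
  family `X ⟶ Spec ℂ`, whose fibre inclusion is an isomorphism — the tree's
  `Theorems.isIso_fiberι_toSpecOver'` and `Theorems.isSmoothProjectiveFamily_toSpecOver`, reused by
  name as the gate's dedup requires), `nonempty_hodgeModel_of_hodgeConjecture`;
* `hodgeConjecture_iff_transport_and_anchorSupply : HodgeConjecture ↔
  (∀ n X, nonempty_hodgeModel n X) ∧ Transport ∧ AnchorSupply`.

So the conjecture is EXACTLY the conjunction of a deformation-theoretic statement (T), whose only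
known engines are semiregularity / unobstructedness theorems (Bloch; Buchweitz–Flenner; Pridham;
the pro-representability of twisted deformations), and a statement about the global geometry of Hodge
loci (A), whose only known engines are density theorems for special points (CM points of
Shimura-type components; Fermat points of hypersurface families). Where each engine breaks is
recorded in the residency's `PLAN.md` §3 and `paper/special-points.md` §7; neither (T) nor (A) is
claimed here.

References: A. Grothendieck, *On the de Rham cohomology of algebraic varieties*, Publ. IHÉS 29 (1966),
footnote 13; S. Bloch, *Semi-regularity and de Rham cohomology*, Invent. Math. 17 (1972), §7;
R.-O. Buchweitz, H. Flenner, *A semiregularity map for modules and applications to deformations*,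
Compositio 137 (2003); E. Cattani, P. Deligne, A. Kaplan, JAMS 8 (1995); C. Voisin, *Hodge loci and
absolute Hodge classes*, Compositio 143 (2007), §0–1; P. Deligne, *The Hodge conjecture* (Clay, 2000).
-/

noncomputable section

open CategoryTheory CategoryTheory.Limits AlgebraicGeometry Topology
open Literature.AlgebraicGeometry Literature.AlgebraicGeometry.Motives
open Literature.AlgebraicGeometry.HodgeTheory
open Literature.AlgebraicTopology.SingularHomology

namespace Summit.HodgeConjecture.HodgeConjecture.Theorems.SoloBlind

/-! ### The three statements -/

/-- **(T) Transport** (variational Hodge conjecture along components of the locus of Hodge classes):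
for every smooth projective family `f : 𝒳 ⟶ S` of relative dimension `n` over `ℂ`, every `p` and all
fibre classes `x`, `y` with `y` in the connected component of the locus of Hodge classes through `x`:
if `x.cls` is algebraic on `𝒳_{x.pt}` then `y.cls` is algebraic on `𝒳_{y.pt}`.
[cite: Grothendieck1966, footnote 13] [cite: Bloch1972Semiregularity, Thm. 7.1] -/
@[conjecture] def Transport : Prop :=
  ∀ ⦃n : ℕ⦄ ⦃𝒳 S : SchemeOver ℂ⦄ ⦃f : 𝒳 ⟶ S⦄, IsSmoothProjectiveFamily f n →
    ∀ (p : ℕ) (x y : FiberClass f (2 * p)),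
      y ∈ connectedComponentIn (locusOfHodgeClasses f n p) x →
      x.cls ∈ algebraicClasses (fiberOver f x.pt) p →
      y.cls ∈ algebraicClasses (fiberOver f y.pt) p

/-- **(A) Anchor supply**: for every smooth projective `X` of dimension `n`, every `p` and every
rational class `c` of Hodge type `(p,p)` on `X`, there are a smooth projective family `f : 𝒳 ⟶ S` of
relative dimension `n`, a point `s ∈ S(ℂ)` with an isomorphism `e : 𝒳_s ≅ X`, and a fibre class `y`
in the connected component of the locus of Hodge classes through `(s, e^* c)` whose class is
algebraic (an *anchor* for `c`). [cite: Voisin2007HodgeLoci, §0] -/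
@[conjecture] def AnchorSupply : Prop :=
  ∀ ⦃n : ℕ⦄ ⦃X : SchemeOver ℂ⦄, IsSmoothProjective n X →
    ∀ (p : ℕ) (c : complexBetti X (2 * p)), IsRationalClass c → IsOfHodgeType n X (2 * p) p p c →
      ∃ (𝒳 S : SchemeOver ℂ) (f : 𝒳 ⟶ S) (_ : IsSmoothProjectiveFamily f n)
        (s : ComplexPoints S) (e : fiberOver f s ≅ X) (y : FiberClass f (2 * p)),
        y ∈ connectedComponentIn (locusOfHodgeClasses f n p)
            ⟨s, complexBetti.map e.hom (2 * p) c⟩ ∧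
          y.cls ∈ algebraicClasses (fiberOver f y.pt) p

/-! ### The Hodge conjecture implies (T), (A) and the existence of Hodge models -/

/-- The Hodge conjecture contains the existence of Hodge models (first conjunct of
`HodgeConjectureFor`). [cite: Deligne2000, §1] -/
theorem nonempty_hodgeModel_of_hodgeConjecture (h : _root_.HodgeConjecture) (n : ℕ) (X : SchemeOver ℂ) :
    nonempty_hodgeModel n X :=
  fun hX => (h hX).1

/-- **HC ⇒ (T)**: classes in the locus of Hodge classes are rational `(p,p)`-classes on smooth
projective fibres, hence algebraic under the Hodge conjecture. [cite: Deligne2000, §1] -/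
theorem transport_of_hodgeConjecture (h : _root_.HodgeConjecture) : Transport := by
  intro n 𝒳 S f hf p x y hy _
  have hyL : y ∈ locusOfHodgeClasses f n p := connectedComponentIn_subset _ _ hy
  exact (h (hf.isSmoothProjective y.pt)).2 p y.cls hyL.1 hyL.2

/-- The fibre class `(s, e^* c)` of a rational `(p,p)`-class `c` on `X ≅ 𝒳_s` lies in the locus of
Hodge classes (rationality and Hodge type transport along `e`). [cite: Voisin2007HodgeLoci, §1] -/
theorem mk_map_mem_locusOfHodgeClasses {n : ℕ} {𝒳 S X : SchemeOver ℂ} {f : 𝒳 ⟶ S} {p : ℕ}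
    {s : ComplexPoints S} (e : fiberOver f s ≅ X) {c : complexBetti X (2 * p)}
    (hc : IsRationalClass c) (hh : IsOfHodgeType n X (2 * p) p p c) :
    (⟨s, complexBetti.map e.hom (2 * p) c⟩ : FiberClass f (2 * p)) ∈ locusOfHodgeClasses f n p := by
  rw [mem_locusOfHodgeClasses_iff]
  dsimp only
  exact ⟨(isRationalClass_map_iff_of_iso e).2 hc, (isOfHodgeType_map_iff_of_iso e).2 hh⟩

/-- **HC ⇒ (A)**: under the Hodge conjecture every Hodge class is its own anchor, in the trivial
family `X ⟶ Spec ℂ`. [cite: Deligne2000, §1] -/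
theorem anchorSupply_of_hodgeConjecture (h : _root_.HodgeConjecture) : AnchorSupply := by
  intro n X hX p c hc hh
  haveI : IsIso (fiberι (toSpecOver X) (𝟙 (specOver ℂ ℂ))) := Theorems.isIso_fiberι_toSpecOver' _
  refine ⟨X, specOver ℂ ℂ, toSpecOver X, Theorems.isSmoothProjectiveFamily_toSpecOver hX,
    𝟙 (specOver ℂ ℂ), asIso (fiberι (toSpecOver X) (𝟙 (specOver ℂ ℂ))),
    ⟨𝟙 (specOver ℂ ℂ),
      complexBetti.map (asIso (fiberι (toSpecOver X) (𝟙 (specOver ℂ ℂ)))).hom (2 * p) c⟩,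
    mem_connectedComponentIn (mk_map_mem_locusOfHodgeClasses _ hc hh), ?_⟩
  dsimp only
  exact (mem_algebraicClasses_map_iff_of_iso _).2 ((h hX).2 p c hc hh)

/-! ### The three statements imply the Hodge conjecture -/

/-- **Transport backwards from an anchor**: if `y` lies in the connected component of the locus of
Hodge classes through the Hodge class `x` and `y` is algebraic, then `x` is algebraic (components are
symmetric: `connectedComponentIn_eq`). [cite: Grothendieck1966, footnote 13] -/
theorem Transport.of_mem_connectedComponentIn (hT : Transport) {n : ℕ} {𝒳 S : SchemeOver ℂ}
    {f : 𝒳 ⟶ S} (hf : IsSmoothProjectiveFamily f n) {p : ℕ} {x y : FiberClass f (2 * p)}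
    (hx : x ∈ locusOfHodgeClasses f n p)
    (hy : y ∈ connectedComponentIn (locusOfHodgeClasses f n p) x)
    (hyalg : y.cls ∈ algebraicClasses (fiberOver f y.pt) p) :
    x.cls ∈ algebraicClasses (fiberOver f x.pt) p := by
  have hxy : x ∈ connectedComponentIn (locusOfHodgeClasses f n p) y := by
    rw [← connectedComponentIn_eq hy]
    exact mem_connectedComponentIn hx
  exact hT hf p y x hxy hyalg

/-- **(models) ∧ (T) ∧ (A) ⇒ HC** — modus ponens along the component: the anchor `y` of `(s, e^* c)`
is algebraic, transport along the connected component of the locus of Hodge classes makes `e^* c`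
algebraic on the fibre `𝒳_s ≅ X`, and algebraicity transports along `e`.
[cite: Grothendieck1966, footnote 13] [cite: Voisin2007HodgeLoci, §0] -/
theorem hodgeConjecture_of_transport_of_anchorSupply
    (hM : ∀ (n : ℕ) (X : SchemeOver ℂ), nonempty_hodgeModel n X) (hT : Transport)
    (hA : AnchorSupply) : _root_.HodgeConjecture := by
  intro n X hX
  refine ⟨hM n X hX, fun p c hc hh => ?_⟩
  obtain ⟨𝒳, S, f, hf, s, e, y, hy, hyalg⟩ := hA hX p c hc hh
  have halg := hT.of_mem_connectedComponentIn hf (mk_map_mem_locusOfHodgeClasses e hc hh) hy hyalg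
  dsimp only at halg
  exact (mem_algebraicClasses_map_iff_of_iso e).1 halg

/-- **The path.** The Hodge conjecture is equivalent to: Hodge models exist, algebraicity is
constant along connected components of loci of Hodge classes (T), and every Hodge class has an
anchor (A). [cite: Grothendieck1966, footnote 13] [cite: Deligne2000, §1] -/
theorem hodgeConjecture_iff_transport_and_anchorSupply :
    _root_.HodgeConjecture ↔
      (∀ (n : ℕ) (X : SchemeOver ℂ), nonempty_hodgeModel n X) ∧ Transport ∧ AnchorSupply :=
  ⟨fun h => ⟨nonempty_hodgeModel_of_hodgeConjecture h, transport_of_hodgeConjecture h,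
      anchorSupply_of_hodgeConjecture h⟩,
    fun h => hodgeConjecture_of_transport_of_anchorSupply h.1 h.2.1 h.2.2⟩

end Summit.HodgeConjecture.HodgeConjecture.Theorems.SoloBlind

end
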